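import Summits.AtomisticToContinuum.HydrodynamicLimit.Theorems.CollisionIsometryCLTDiffuseBackwardInfluenceContainers

/-!
# The container bound for pairwise non-adjacency on a PRESCRIBED index set
(crux `DiffuseBackwardInfluence`, stmt-AtomisticToContinuum-12950, line `share-nondegeneracy-one-flight`; support file of
the lead's stub `stub_stickLD`, registered sub-goal `pi_setOf_pairwise_not_adj_on_le`)

Companion of `…Containers.lean` (`pi_setOf_pairwise_not_adj_le`: i.i.d. samples pairwise avoiding a measurable relation
under supersaturation). The stick large deviation `FewIdle.StickLD` constrains only the pairs INSIDE an index set `A`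
of the `N + 1` particles (the other coordinates are free), so this file proves the same Kleitman–Winston bound with
fingerprints ranging over subsets of `A` and exponent `|A| - t`:
`ν^{⊗k} {Z | ∀ i, j ∈ A, i ≠ j → ¬ Adj (Z i) (Z j)} ≤ ∑_{t ≤ f} (|A| choose t) ρ₀^{|A| - t}`.
The cover lemma (`exists_fingerprint_on`: a maximum-size `I ⊆ A` under the budget `ν(C_I) + |I| d ≤ 1`), the
one-fingerprint bound (`pi_fingerprintEventOn_le`: split `ν^{⊗k}` along `I`; the section is a product set whose
constrained coordinates are exactly `A \ I`) and the count are those of the companion file, verbatim up to `A`.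
-/

namespace Summit.AtomisticToContinuum.HydrodynamicLimit.Theorems.DiffuseBackwardInfluenceShare

namespace Containers

open scoped BigOperators ENNReal Classical
open Set MeasureTheory Filter

noncomputable section

variable {Ω : Type*} [MeasurableSpace Ω] {Adj : Ω → Ω → Prop} {k : ℕ}

/-! ## §5 The same bound for pairwise non-adjacency on a PRESCRIBED index set `A`

The stick large deviation constrains only the pairs inside an index set `A` (the other coordinates are free); the
fingerprints then range over subsets of `A` and the exponent is `|A| - t`. -/

/-- **Cover lemma on `A`.** If `Z` is pairwise non-adjacent on `A` then some `I ⊆ A` with `|I| · d ≤ 1` has every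
`Z j`, `j ∈ A \ I`, inside the container of `I`. -/
theorem exists_fingerprint_on (ν : Measure Ω) [IsProbabilityMeasure ν]
    (hAdj : MeasurableSet {p : Ω × Ω | Adj p.1 p.2}) (d : ℝ≥0∞) {Z : Fin k → Ω} (A : Finset (Fin k))
    (hZ : ∀ i ∈ A, ∀ j ∈ A, i ≠ j → ¬ Adj (Z i) (Z j)) :
    ∃ I : Finset (Fin k), I ⊆ A ∧ (I.card : ℝ≥0∞) * d ≤ 1 ∧ ∀ j ∈ A, j ∉ I → Z j ∈ cont ν Adj d Z I := by
  set adm : Finset (Finset (Fin k)) :=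
    A.powerset.filter fun I => ν (avoidSet Adj Z I) + (I.card : ℝ≥0∞) * d ≤ 1 with hadm
  have hne : adm.Nonempty := by
    refine ⟨∅, Finset.mem_filter.2 ⟨Finset.empty_mem_powerset A, ?_⟩⟩
    simp only [Finset.card_empty, Nat.cast_zero, zero_mul, add_zero]
    exact prob_le_one
  obtain ⟨I, hI, hmax⟩ := adm.exists_max_image Finset.card hne
  have hIA : I ⊆ A := Finset.mem_powerset.1 (Finset.mem_filter.1 hI).1
  have hIadm : ν (avoidSet Adj Z I) + (I.card : ℝ≥0∞) * d ≤ 1 := (Finset.mem_filter.1 hI).2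
  refine ⟨I, hIA, le_trans le_add_self hIadm, fun j hjA hj => ?_⟩
  have hjC : Z j ∈ avoidSet Adj Z I := fun i hi => hZ i (hIA hi) j hjA (fun h => hj (h ▸ hi))
  refine ⟨hjC, ?_⟩
  by_contra hdeg
  have hdeg' : d ≤ ν ({z' | Adj (Z j) z'} ∩ avoidSet Adj Z I) := not_lt.1 hdeg
  have hins : ν (avoidSet Adj Z (insert j I)) + ((insert j I).card : ℝ≥0∞) * d ≤ 1 := by
    rw [avoidSet_insert, Finset.card_insert_of_notMem hj]
    have hsplit := measure_inter_add_sdiff (μ := ν) (avoidSet Adj Z I) (measurableSet_shadow hAdj (Z j))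
    push_cast
    rw [add_mul, one_mul]
    calc ν (avoidSet Adj Z I \ {z' | Adj (Z j) z'}) + ((I.card : ℝ≥0∞) * d + d)
        = (d + ν (avoidSet Adj Z I \ {z' | Adj (Z j) z'})) + (I.card : ℝ≥0∞) * d := by ring
      _ ≤ (ν ({z' | Adj (Z j) z'} ∩ avoidSet Adj Z I) + ν (avoidSet Adj Z I \ {z' | Adj (Z j) z'})) +
            (I.card : ℝ≥0∞) * d := by gcongr
      _ = ν (avoidSet Adj Z I) + (I.card : ℝ≥0∞) * d := by rw [inter_comm, hsplit]
      _ ≤ 1 := hIadm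
  have hmem : insert j I ∈ adm :=
    Finset.mem_filter.2 ⟨Finset.mem_powerset.2 (Finset.insert_subset hjA hIA), hins⟩
  have hcard := hmax _ hmem
  rw [Finset.card_insert_of_notMem hj] at hcard
  omega

/-- The event "every sample point of `A` outside `I` lies in the container of `I`". -/
def fingerprintEventOn (ν : Measure Ω) (Adj : Ω → Ω → Prop) (d : ℝ≥0∞) (k : ℕ) (A I : Finset (Fin k)) :
    Set (Fin k → Ω) :=
  {Z | ∀ j ∈ A, j ∉ I → Z j ∈ cont ν Adj d Z I}

/-- **One fingerprint on `A`.** If all containers have measure `≤ ρ₀` and `I ⊆ A` then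
`ν^{⊗k} {Z | ∀ j ∈ A \ I, Z j ∈ cont_I(Z)} ≤ ρ₀^{|A| - |I|}`. -/
theorem pi_fingerprintEventOn_le (ν : Measure Ω) [IsProbabilityMeasure ν]
    (hAdj : MeasurableSet {p : Ω × Ω | Adj p.1 p.2}) (d : ℝ≥0∞) {ρ₀ : ℝ≥0∞}
    {A I : Finset (Fin k)} (hIA : I ⊆ A) (hcont : ∀ a : {i // i ∈ I} → Ω, ν (cont' ν Adj d a) ≤ ρ₀) :
    Measure.pi (fun _ : Fin k => ν) (fingerprintEventOn ν Adj d k A I) ≤ ρ₀ ^ (A.card - I.card) := by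
  set p : Fin k → Prop := fun i => i ∈ I with hp
  have hmp := measurePreserving_piEquivPiSubtypeProd (fun _ : Fin k => ν) p
  set e := MeasurableEquiv.piEquivPiSubtypeProd (fun _ : Fin k => Ω) p with he
  set F : Set (({i // p i} → Ω) × ({i // ¬ p i} → Ω)) :=
    {q | ∀ j : {i // ¬ p i}, (j.1 ∈ A) → q.2 j ∈ cont' ν Adj d q.1} with hF
  have hpre : fingerprintEventOn ν Adj d k A I = e ⁻¹' F := by
    ext Z
    simp only [fingerprintEventOn, mem_setOf_eq, mem_preimage, hF, cont_eq_cont', Subtype.forall, hp]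
    constructor
    · intro h j hj hjA
      simpa [he, MeasurableEquiv.piEquivPiSubtypeProd] using h j hjA hj
    · intro h j hjA hj
      simpa [he, MeasurableEquiv.piEquivPiSubtypeProd] using h j hj hjA
  have hFm : MeasurableSet F := by
    have : F = ⋂ j : {i // ¬ p i}, {q : ({i // p i} → Ω) × ({i // ¬ p i} → Ω) |
        (j.1 ∈ A) → q.2 j ∈ cont' ν Adj d q.1} := by
      ext q; simp [hF]
    rw [this]
    refine MeasurableSet.iInter fun j => ?_
    by_cases hjA : j.1 ∈ A
    · have : {q : ({i // p i} → Ω) × ({i // ¬ p i} → Ω) | (j.1 ∈ A) → q.2 j ∈ cont' ν Adj d q.1} =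
          (fun q : ({i // p i} → Ω) × ({i // ¬ p i} → Ω) => (q.1, q.2 j)) ⁻¹'
            {q : ({i // p i} → Ω) × Ω | q.2 ∈ cont' ν Adj d q.1} := by
        ext q; simp [hjA]
      rw [this]
      exact (measurable_fst.prodMk ((measurable_pi_apply j).comp measurable_snd))
        (measurableSet_graph_cont' ν hAdj d I)
    · have : {q : ({i // p i} → Ω) × ({i // ¬ p i} → Ω) | (j.1 ∈ A) → q.2 j ∈ cont' ν Adj d q.1} = univ := by
        ext q; simp [hjA]
      rw [this]
      exact MeasurableSet.univ
  rw [hpre, hmp.measure_preimage hFm.nullMeasurableSet, Measure.prod_apply hFm]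
  -- the section at `a` is a product set
  have hsec : ∀ a : {i // p i} → Ω, Prod.mk a ⁻¹' F =
      Set.pi univ fun j : {i // ¬ p i} => if j.1 ∈ A then cont' ν Adj d a else univ := by
    intro a; ext b
    simp only [hF, mem_preimage, mem_setOf_eq, mem_univ_pi]
    refine forall_congr' fun j => ?_
    by_cases hjA : j.1 ∈ A <;> simp [hjA]
  -- the number of constrained coordinates is `|A| - |I|`
  have hcard : (Finset.univ.filter fun j : {i // ¬ p i} => j.1 ∈ A).card = A.card - I.card := by
    rw [← Finset.card_sdiff_of_subset hIA]
    refine Finset.card_bij (fun j _ => j.1) (fun j hj => ?_) (fun j₁ _ j₂ _ h => Subtype.ext h) (fun i hi => ?_)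
    · simp only [Finset.mem_filter, Finset.mem_univ, true_and] at hj
      exact Finset.mem_sdiff.2 ⟨hj, j.2⟩
    · obtain ⟨hiA, hiI⟩ := Finset.mem_sdiff.1 hi
      exact ⟨⟨i, hiI⟩, by simp [hiA], rfl⟩
  refine le_trans (lintegral_mono (g := fun _ => ρ₀ ^ (A.card - I.card)) fun a => ?_) ?_
  · show (Measure.pi fun _ : {i // ¬ p i} => ν) (Prod.mk a ⁻¹' F) ≤ ρ₀ ^ (A.card - I.card)
    rw [hsec a, Measure.pi_pi]
    have hprod : (∏ j : {i // ¬ p i}, ν (if j.1 ∈ A then cont' ν Adj d a else univ)) =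
        ∏ j : {i // ¬ p i}, (if j.1 ∈ A then ν (cont' ν Adj d a) else 1) := by
      refine Finset.prod_congr rfl fun j _ => ?_
      split_ifs
      · rfl
      · exact measure_univ
    rw [hprod, Finset.prod_ite, Finset.prod_const_one, mul_one, Finset.prod_const, hcard]
    exact pow_le_pow_left₀ bot_le (hcont a) _
  · rw [lintegral_const, measure_univ, mul_one]

/-- **THE CONTAINER BOUND ON A PRESCRIBED INDEX SET** (registered sub-goal of the crux item, support of `stub_stickLD`):
under the hypotheses of `pi_setOf_pairwise_not_adj_le`, for every index set `A ⊆ Fin k` the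
`ν^{⊗k}`-probability that the samples indexed by `A` are pairwise non-adjacent is at most
`∑_{t=0}^{f} (|A| choose t) ρ₀^{|A| - t}`. -/
theorem pi_setOf_pairwise_not_adj_on_le : ∀ {Ω : Type} [MeasurableSpace Ω] (ν : Measure Ω) [IsProbabilityMeasure ν] (Adj : Ω → Ω → Prop), MeasurableSet {p : Ω × Ω | Adj p.1 p.2} → ∀ (d ρ₀ : ℝ≥0∞), 0 < d → d ≠ ⊤ → 0 < ρ₀ → (∀ S : Set Ω, MeasurableSet S → ρ₀ ≤ ν S → 2 * d * ν S ≤ ∫⁻ z in S, ν ({z' | Adj z z'} ∩ S) ∂ν) → ∀ (k f : ℕ), d⁻¹ ≤ (f : ℝ≥0∞) → ∀ A : Finset (Fin k), Measure.pi (fun _ : Fin k => ν) {Z : Fin k → Ω | ∀ i ∈ A, ∀ j ∈ A, i ≠ j → ¬ Adj (Z i) (Z j)} ≤ ∑ t ∈ Finset.range (f + 1), ((A.card.choose t : ℕ) : ℝ≥0∞) * ρ₀ ^ (A.card - t) := by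
  intro Ω _ ν _ Adj hAdj d ρ₀ hd hdtop hρ₀ hsat k f hf A
  have hcont : ∀ (I : Finset (Fin k)) (a : {i // i ∈ I} → Ω), ν (cont' ν Adj d a) ≤ ρ₀ :=
    fun I a => measure_cont'_le ν hAdj hd hdtop hρ₀ hsat I a
  have hcover : {Z : Fin k → Ω | ∀ i ∈ A, ∀ j ∈ A, i ≠ j → ¬ Adj (Z i) (Z j)} ⊆
      ⋃ t ∈ Finset.range (f + 1), ⋃ I ∈ Finset.powersetCard t A, fingerprintEventOn ν Adj d k A I := by
    intro Z hZ
    obtain ⟨I, hIA, hIcard, hI⟩ := exists_fingerprint_on ν hAdj d A hZ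
    have hle : I.card ≤ f := by
      have h1 : (I.card : ℝ≥0∞) ≤ d⁻¹ := ENNReal.le_inv_iff_mul_le.2 hIcard
      exact_mod_cast h1.trans hf
    simp only [mem_iUnion, Finset.mem_range, Finset.mem_powersetCard, exists_prop]
    exact ⟨I.card, Nat.lt_succ_of_le hle, I, ⟨hIA, rfl⟩, hI⟩
  calc Measure.pi (fun _ : Fin k => ν) {Z : Fin k → Ω | ∀ i ∈ A, ∀ j ∈ A, i ≠ j → ¬ Adj (Z i) (Z j)}
      ≤ Measure.pi (fun _ : Fin k => ν) (⋃ t ∈ Finset.range (f + 1),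
          ⋃ I ∈ Finset.powersetCard t A, fingerprintEventOn ν Adj d k A I) := measure_mono hcover
    _ ≤ ∑ t ∈ Finset.range (f + 1), Measure.pi (fun _ : Fin k => ν)
          (⋃ I ∈ Finset.powersetCard t A, fingerprintEventOn ν Adj d k A I) :=
        measure_biUnion_finset_le _ _
    _ ≤ ∑ t ∈ Finset.range (f + 1), ∑ I ∈ Finset.powersetCard t A,
          Measure.pi (fun _ : Fin k => ν) (fingerprintEventOn ν Adj d k A I) :=
        Finset.sum_le_sum fun t _ => measure_biUnion_finset_le _ _
    _ ≤ ∑ t ∈ Finset.range (f + 1), ∑ I ∈ Finset.powersetCard t A, ρ₀ ^ (A.card - t) := by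
        refine Finset.sum_le_sum fun t _ => Finset.sum_le_sum fun I hI => ?_
        obtain ⟨hIA, hIt⟩ := Finset.mem_powersetCard.1 hI
        exact (pi_fingerprintEventOn_le ν hAdj d hIA (hcont I)).trans_eq (by rw [hIt])
    _ = ∑ t ∈ Finset.range (f + 1), ((A.card.choose t : ℕ) : ℝ≥0∞) * ρ₀ ^ (A.card - t) := by
        refine Finset.sum_congr rfl fun t _ => ?_
        rw [Finset.sum_const, Finset.card_powersetCard, nsmul_eq_mul]

end

end Containers

end Summit.AtomisticToContinuum.HydrodynamicLimit.Theorems.DiffuseBackwardInfluenceShare
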